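import Literature.Topology.FourManifolds.ResolutionNeckPiece
import Literature.Topology.FourManifolds.PlumbingCoordinatesOfArcs
import Literature.Topology.FourManifolds.SurfaceTimesTorusTube
import HarnessLib

/-!
# Placement facts in the plumbing charts of `T⁴` for the tube of `Σ̄₂`

Topic `Literature/Topology/FourManifolds` (block 2 of Akhmedov–Park's `X₁(m)`, Invent. Math.
181 (2010), §3; bookkeeping for the instantiation of the tube of `Σ̄₂ ⊂ T⁴ # ℂℙ²bar`,
everything PROVED, no definitions).  For the model `e : X ≃ (T × S¹) × S¹` of `T⁴` with its
product tube `T₁` (`SurfaceTimesTorusTube.lean`) and a plumbing chart `P` built on a surface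
chart `eF` (`SurfaceTimesTorusPlumbingChart.lean`, bound here by its source, value and inverse
formulas) we record the elementary consequences used to place the neck, the caps and the far
pieces:

* `mem_eF_of_tube_mem` — `T₁ (p, v) ∈ P.source → p ∈ eF.source`;
* `fst_e_symm`, `x_coord_symm_fromC2` — the `T`-coordinate of `P⁻¹ (fromC2 z)` lies in
  `eF.source` with complex chart value `z.1`;
* `x_coord_of_mem` — for `x ∈ P.source` the `T`-coordinate is in `eF.source` with chart value
  `(toC2 (P x)).1`, of norm `≤ ‖P x‖`;
* `symm_zero_eq_tube` — `P⁻¹ 0 = T₁ (eF⁻¹ 0, 0)`, the double point;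
* `tube_snd_coord` — `c (Im y₁/Re y₁, Im y₂/Re y₂) = c · cx v` for `y = e (T₁ (p, v))`;
* `thinArc_x_coord` — `into (xs · A v) ∈ eQ.source` with complex value `c′ r(v)` for the scaled
  quarter chart `eQ` of the torus at `xs` and the thin arcs `A v`.

## References

* A. Akhmedov, B. D. Park, Invent. Math. 181 (2010) 577–603, §3. [AkhmedovPark2010]
-/

noncomputable section

open scoped Manifold ContDiff Topology Real
open Set Function Complex
open Literature.Geometry.Manifold (Rechart)
open Literature.Topology.FourManifolds.ToricBlowup

namespace Literature.Topology.FourManifolds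

namespace PlumbingPlacement

/-! ### §0 Norms of the two complex coordinates of `ℝ⁴` -/

/-- Each complex coordinate of `w ∈ ℝ⁴` is bounded by `‖w‖`. [folklore] -/
theorem norm_toC2_le (w : EuclideanSpace ℝ (Fin 4)) : ‖(toC2 w).1‖ ≤ ‖w‖ ∧ ‖(toC2 w).2‖ ≤ ‖w‖ := by
  have h := norm_sq_eq_normSq w
  rw [Complex.normSq_eq_norm_sq, Complex.normSq_eq_norm_sq] at h
  have h0 := norm_nonneg w
  have h1 := norm_nonneg (toC2 w).1
  have h2 := norm_nonneg (toC2 w).2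
  constructor
  · nlinarith
  · nlinarith

/-! ### §1 The plumbing chart -/

section Data

variable {F : Type} [TopologicalSpace F]
  {X : Type*} [TopologicalSpace X]
  {cx : EuclideanSpace ℝ (Fin 2) → ℂ} {vc : ℂ → EuclideanSpace ℝ (Fin 2)}
  {e : X ≃ₜ (F × Circle) × Circle}
  {eF : OpenPartialHomeomorph F (EuclideanSpace ℝ (Fin 2))}
  {P : OpenPartialHomeomorph X (EuclideanSpace ℝ (Fin 4))}
  {T₁ : F × EuclideanSpace ℝ (Fin 2) → X} {c : ℝ}

variable (hcx : ∀ v, cx v = ⟨v 0, v 1⟩)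
  (hvc : ∀ z, vc z = z.re • EuclideanSpace.single 0 (1 : ℝ) + z.im • EuclideanSpace.single 1 (1 : ℝ))
  (heFt : eF.target = univ)
  (hT₁e : ∀ (p : F) (v : EuclideanSpace ℝ (Fin 2)),
    e (T₁ (p, v)) = ((p, Circle.exp (Real.arctan (v 0))), Circle.exp (Real.arctan (v 1))))
  (hPs : P.source = {x | (e x).1.1 ∈ eF.source ∧ 0 < (((e x).1.2 : Circle) : ℂ).re ∧
      0 < (((e x).2 : Circle) : ℂ).re})
  (hPv : ∀ x, toC2 (P x) = ((⟨eF (e x).1.1 0, eF (e x).1.1 1⟩ : ℂ),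
      (⟨c * ((((e x).1.2 : Circle) : ℂ).im / (((e x).1.2 : Circle) : ℂ).re),
        c * ((((e x).2 : Circle) : ℂ).im / (((e x).2 : Circle) : ℂ).re)⟩ : ℂ)))
  (hPsymm : ∀ w : EuclideanSpace ℝ (Fin 4), P.symm w = e.symm
      ((eF.symm ((toC2 w).1.re • EuclideanSpace.single 0 (1 : ℝ) +
          (toC2 w).1.im • EuclideanSpace.single 1 (1 : ℝ)),
        Circle.exp (Real.arctan ((toC2 w).2.re / c))), Circle.exp (Real.arctan ((toC2 w).2.im / c))))

include hT₁e hPs in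
/-- `T₁ (p, v) ∈ P.source → p ∈ eF.source` (the `T`-coordinate of `T₁ (p, v)` is `p`). [folklore] -/
theorem mem_eF_of_tube_mem {p : F} {v : EuclideanSpace ℝ (Fin 2)} (h : T₁ (p, v) ∈ P.source) :
    p ∈ eF.source := by
  rw [hPs, mem_setOf_eq, hT₁e] at h
  exact h.1

include hvc hPsymm in
/-- **The `T`-coordinate of `P⁻¹ w`** is `eF⁻¹ (vc (toC2 w).1)`. [folklore] -/
theorem fst_e_symm (w : EuclideanSpace ℝ (Fin 4)) : (e (P.symm w)).1.1 = eF.symm (vc (toC2 w).1) := by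
  rw [hPsymm, Homeomorph.apply_symm_apply, hvc]

include hcx hPs hPv in
/-- **The `T`-coordinate of a point of the chart domain**: it lies in `eF.source`, its complex
chart value is `(toC2 (P x)).1`, of norm `≤ ‖P x‖`. [folklore] -/
theorem x_coord_of_mem {x : X} (hx : x ∈ P.source) :
    (e x).1.1 ∈ eF.source ∧ cx (eF (e x).1.1) = (toC2 (P x)).1 ∧ ‖cx (eF (e x).1.1)‖ ≤ ‖P x‖ := by
  have hmem : (e x).1.1 ∈ eF.source := by rw [hPs] at hx; exact hx.1
  have hval : cx (eF (e x).1.1) = (toC2 (P x)).1 := by rw [hPv, hcx]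
  exact ⟨hmem, hval, by rw [hval]; exact (norm_toC2_le _).1⟩

include hcx hvc heFt hPsymm in
/-- **The `T`-coordinate of a point `P⁻¹ (fromC2 z)`** lies in `eF.source` and has complex chart
value `z.1`. [folklore] -/
theorem x_coord_symm_fromC2 (z : ℂ × ℂ) :
    (e (P.symm (fromC2 z))).1.1 ∈ eF.source ∧ cx (eF (e (P.symm (fromC2 z))).1.1) = z.1 := by
  rw [fst_e_symm hvc hPsymm, toC2_fromC2]
  have ht : vc z.1 ∈ eF.target := by rw [heFt]; exact mem_univ _
  exact ⟨eF.map_target ht, by rw [eF.right_inv ht, NeckPiece.cx_vc hcx hvc]⟩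

include hT₁e hPsymm in
/-- **The centre of the plumbing chart is the double point**: `P⁻¹ 0 = T₁ (eF⁻¹ 0, 0)`. [folklore] -/
theorem symm_zero_eq_tube : P.symm 0 = T₁ (eF.symm 0, 0) := by
  apply e.injective
  rw [hPsymm, Homeomorph.apply_symm_apply, hT₁e, toC2_zero]
  have h0 : (0 : ℂ).re • EuclideanSpace.single (0 : Fin 2) (1 : ℝ) +
      (0 : ℂ).im • EuclideanSpace.single (1 : Fin 2) (1 : ℝ) = 0 := by simp
  have h1 : ((0 : ℂ × ℂ).1) = 0 := rfl
  have h2 : ((0 : ℂ × ℂ).2) = 0 := rfl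
  rw [h1, h2, h0]
  simp

include hcx hT₁e in
/-- **The second plumbing coordinate of the product tube**: for `y = e (T₁ (p, v))`,
`c (Im y₁/Re y₁, Im y₂/Re y₂) = c · cx v`, and both `Re yᵢ > 0`. [folklore] -/
theorem tube_snd_coord (p : F) (v : EuclideanSpace ℝ (Fin 2)) :
    (⟨c * ((((e (T₁ (p, v))).1.2 : Circle) : ℂ).im / (((e (T₁ (p, v))).1.2 : Circle) : ℂ).re),
        c * ((((e (T₁ (p, v))).2 : Circle) : ℂ).im / (((e (T₁ (p, v))).2 : Circle) : ℂ).re)⟩ : ℂ) =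
      (c : ℂ) * cx v ∧
    0 < ((((e (T₁ (p, v))).1.2 : Circle)) : ℂ).re ∧ 0 < ((((e (T₁ (p, v))).2 : Circle)) : ℂ).re := by
  rw [hT₁e]
  refine ⟨?_, re_circleExp_arctan_pos _, re_circleExp_arctan_pos _⟩
  rw [im_div_re_circleExp_arctan, im_div_re_circleExp_arctan, hcx]
  apply Complex.ext <;> simp

include hcx hT₁e hPv in
/-- **Plumbing coordinates of the product tube** (for the total chart function):
`toC2 (P (T₁ (p, v))) = (cx (eF p), c · cx v)`. [folklore] -/
theorem tube_coords {p : F} {v : EuclideanSpace ℝ (Fin 2)} :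
    toC2 (P (T₁ (p, v))) = (cx (eF p), (c : ℂ) * cx v) := by
  obtain ⟨h1, -, -⟩ := tube_snd_coord (c := c) hcx hT₁e p v
  rw [hPv, h1]
  congr 1
  rw [hT₁e, hcx]

end Data

/-! ### §2 The thin arcs in a quarter chart of the torus -/

section Arc

variable {f : ModelProd (EuclideanSpace ℝ (Fin 1)) (EuclideanSpace ℝ (Fin 1)) ≃ₜ EuclideanSpace ℝ (Fin 2)}
  {cx rc : EuclideanSpace ℝ (Fin 2) → ℂ}
  {eQ : OpenPartialHomeomorph (Rechart f (Circle × Circle)) (EuclideanSpace ℝ (Fin 2))}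
  {A : EuclideanSpace ℝ (Fin 2) → Circle × Circle} {xs : Circle × Circle} {c' δ : ℝ}

/-- **The thin arcs in the quarter chart at their base point.**  For the scaled quarter chart
`eQ` of the torus at `xs` (source and value formulas of `exists_torusQuarterChart`), the thin
arcs `A v = (e^{i δ arctan v₀/2}, e^{i δ arctan v₁/2})` (`0 ≤ δ ≤ 1`): the point `into (xs · A v)`
lies in `eQ.source` and its complex chart value is `c′ (tan (δ arctan v₀) + i tan (δ arctan v₁))`.
[cite: AkhmedovPark2010, §3] -/
theorem thinArc_x_coord (hcx : ∀ v, cx v = ⟨v 0, v 1⟩) (hδ : 0 ≤ δ) (hδ1 : δ ≤ 1)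
    (hA : ∀ v : EuclideanSpace ℝ (Fin 2),
      A v = (Circle.exp (δ * Real.arctan (v 0) / 2), Circle.exp (δ * Real.arctan (v 1) / 2)))
    (hrc : ∀ u, rc u = ⟨Real.tan (δ * Real.arctan (u 0)), Real.tan (δ * Real.arctan (u 1))⟩)
    (heQs : eQ.source = {x | (0 < ((((Rechart.out f (Circle × Circle) x).1 * xs.1⁻¹ : Circle) : ℂ)).re ∧
        0 < ((((Rechart.out f (Circle × Circle) x).1 * xs.1⁻¹ : Circle) : ℂ) ^ 2).re) ∧
      (0 < ((((Rechart.out f (Circle × Circle) x).2 * xs.2⁻¹ : Circle) : ℂ)).re ∧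
        0 < ((((Rechart.out f (Circle × Circle) x).2 * xs.2⁻¹ : Circle) : ℂ) ^ 2).re)})
    (heQv : ∀ x, eQ x 0 = c' * ((((((Rechart.out f (Circle × Circle) x).1 * xs.1⁻¹ : Circle) : ℂ) ^ 2).im /
        ((((Rechart.out f (Circle × Circle) x).1 * xs.1⁻¹ : Circle) : ℂ) ^ 2).re)) ∧
      eQ x 1 = c' * ((((((Rechart.out f (Circle × Circle) x).2 * xs.2⁻¹ : Circle) : ℂ) ^ 2).im /
        ((((Rechart.out f (Circle × Circle) x).2 * xs.2⁻¹ : Circle) : ℂ) ^ 2).re)))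
    (v : EuclideanSpace ℝ (Fin 2)) :
    Rechart.into f (Circle × Circle) (xs * A v) ∈ eQ.source ∧
      cx (eQ (Rechart.into f (Circle × Circle) (xs * A v))) = (c' : ℂ) * rc v := by
  obtain ⟨q0, p0, s0⟩ := ThinArcPlumbing.circleExp_half_facts (ThinArcPlumbing.abs_mul_arctan_lt hδ hδ1 (v 0)) xs.1
  obtain ⟨q1, p1, s1⟩ := ThinArcPlumbing.circleExp_half_facts (ThinArcPlumbing.abs_mul_arctan_lt hδ hδ1 (v 1)) xs.2
  have h1 : (Rechart.out f (Circle × Circle) (Rechart.into f (Circle × Circle) (xs * A v))).1 * xs.1⁻¹ =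
      xs.1 * Circle.exp (δ * Real.arctan (v 0) / 2) * xs.1⁻¹ := by
    rw [Rechart.out_into, hA, Prod.fst_mul]
  have h2 : (Rechart.out f (Circle × Circle) (Rechart.into f (Circle × Circle) (xs * A v))).2 * xs.2⁻¹ =
      xs.2 * Circle.exp (δ * Real.arctan (v 1) / 2) * xs.2⁻¹ := by
    rw [Rechart.out_into, hA, Prod.snd_mul]
  constructor
  · rw [heQs, mem_setOf_eq, h1, h2]
    exact ⟨⟨p0, s0⟩, ⟨p1, s1⟩⟩
  · obtain ⟨e0, e1⟩ := heQv (Rechart.into f (Circle × Circle) (xs * A v))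
    rw [h1, q0] at e0
    rw [h2, q1] at e1
    rw [hcx, e0, e1, hrc]
    apply Complex.ext <;> simp

end Arc

end PlumbingPlacement

end Literature.Topology.FourManifolds
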